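import Literature.NumberTheory.LFunctions.RHInvZetaBound
import HarnessLib

/-!
# Zero order from zero-freeness for functions of finite order in a half-plane (Titchmarsh §14.2)

Topic `Literature/Analysis/Complex`. Everything in this file is PROVED.

The mechanism behind "RH ⇒ Lindelöf" (Titchmarsh, *The Theory of the Riemann Zeta-Function*,
§14.2; Hilberdink–Lapidus 2006, Thm. 2.3 and Remark (ii); Hilberdink 2005, Thm. A / Remark B(ii)),
isolated as a statement about one holomorphic function: let `F` be holomorphic on the punctured
half-plane `{Re s > β} ∖ {1}`, of finite order there (`‖F(s)‖ ≤ C_δ |t|^A` for `Re s ≥ β + δ`,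
`|t| ≥ 1`), close to `1` far to the right (`‖F(s) − 1‖ ≤ 1/2` for `Re s ≥ σ₁`), and with only
finitely many zeros in `{Re s > θ} ∖ {1}` for some `θ ≥ β`. Then `F` has ZERO ORDER in `Re s > θ`:
for every `σ₀ > θ` and `ε > 0`, `‖F(s)‖ ≤ |t|^ε` for `Re s ≥ σ₀`, `|t| ≥ T(σ₀, ε)`
(`norm_le_rpow_of_finite_zeros`).

Proof (Titchmarsh §14.2, as in the tree's `RHInvZetaBound.lean` for `ζ` under RH, whose general
lemmas `InvZetaRH.exists_log_of_ball` (holomorphic logarithms on discs) and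
`InvZetaRH.norm_le_of_three_circles` (Hadamard) are reused): for `|t|` beyond the ordinates of the
zeros the discs `‖z − (σ₂ + it)‖ < R = σ₂ − θ − δ/2` (`σ₂ = σ₁ + 1`, `δ = (σ₀ − θ)/2`) are free of
zeros and of the point `1`, so `L = log F` exists there with `Re L = log|F| ≤ K₁ log|t|`;
Borel–Carathéodory (Mathlib `Complex.borelCaratheodory`) gives `‖L‖ ≤ K₂ log|t|` on
`‖z − (σ₂+it)‖ ≤ σ₂ − θ − δ`; three circles through `σ₂ − 1/2 + it` (`‖L‖ ≤ 1`), `σ + it`,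
`θ + δ + it` give `‖L(σ+it)‖ ≤ (K₂ log|t|)^{a₀}` with `a₀ < 1`, hence `≤ ε log|t|` for large `|t|`,
and `‖F‖ = e^{Re L} ≤ |t|^ε`; for `Re s ≥ σ₂ − 1/2`, `‖F‖ ≤ 3/2 ≤ |t|^ε` directly.

This is the function-theoretic input of Hilberdink's Corollary 2(b)
(`Literature/Barriers/RiemannHypothesis/BeurlingCounterexamplesProofs.lean`), applied to the
continued Beurling zeta function `ζ_P` (finite order from `N_P(x) = ρx + O(x^β)`).

## References
* [Titchmarsh1986] E. C. Titchmarsh, *The Theory of the Riemann Zeta-Function*, 2nd ed., Oxford 1986,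
  §14.2 (Thm. 14.2, eqs. (14.2.1)–(14.2.6)).
* [HilberdinkLapidus2006] T. W. Hilberdink, M. L. Lapidus, Acta Appl. Math. 94 (2006) 21–48, Thm. 2.3
  and Remark (ii) after it (arXiv:math/0410270, read).
-/

noncomputable section

open Complex Filter Metric Set
open scoped Real Topology

namespace Literature.Analysis.Complex

open Literature.NumberTheory.LFunctions.InvZetaRH (norm_le_of_three_circles exists_log_of_ball)

/-- If `‖w − 1‖ ≤ 1/2` then `‖log w‖ ≤ 1` (principal branch; from Mathlib's
`‖log(1+z)‖ ≤ ‖z‖²(1−‖z‖)⁻¹/2 + ‖z‖`). [folklore] -/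
theorem norm_log_le_one_of_norm_sub_one_le {w : ℂ} (hw : ‖w - 1‖ ≤ 1 / 2) : ‖log w‖ ≤ 1 := by
  set z : ℂ := w - 1 with hz
  have hz1 : ‖z‖ < 1 := by rw [hz]; linarith
  have hw' : w = 1 + z := by rw [hz]; ring
  rw [hw']
  refine (norm_log_one_add_le hz1).trans ?_
  have h0 : 0 ≤ ‖z‖ := norm_nonneg _
  have h1 : ‖z‖ ^ 2 ≤ 1 / 4 := by nlinarith
  have h2 : (1 - ‖z‖)⁻¹ ≤ 2 := by
    rw [inv_le_comm₀ (by linarith) (by norm_num)]; linarith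
  have h3 : 0 ≤ (1 - ‖z‖)⁻¹ := inv_nonneg.mpr (by linarith)
  nlinarith [mul_le_mul h1 h2 h3 (by norm_num : (0 : ℝ) ≤ 1 / 4)]

/-- Geometry of the disc `‖z − (σ₂ + it)‖ < R`: `Re z > σ₂ − R` and `|Im z − t| < R`. [folklore] -/
theorem re_im_of_mem_ball {σ₂ t R : ℝ} {z : ℂ} (hz : z ∈ ball ((σ₂ : ℂ) + t * I) R) :
    σ₂ - R < z.re ∧ |z.im - t| < R := by
  rw [mem_ball, dist_eq_norm] at hz
  have h1 := abs_re_le_norm (z - (σ₂ + t * I))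
  have h2 := abs_im_le_norm (z - (σ₂ + t * I))
  have hre : (z - ((σ₂ : ℂ) + t * I)).re = z.re - σ₂ := by simp
  have him : (z - ((σ₂ : ℂ) + t * I)).im = z.im - t := by simp
  rw [hre] at h1
  rw [him] at h2
  exact ⟨by linarith [neg_abs_le (z.re - σ₂)], by linarith⟩

/-- **Borel–Carathéodory for `log F` on a zero-free disc.** If `F` is holomorphic and zero-free on
`‖z − c‖ < R` with `log ‖F z‖ ≤ M` there (`M > 0`), and `‖F − 1‖ ≤ 1/2` on the half-plane
`Re z ≥ σ₁'` containing the centre (`σ₁' < Re c`), then there is a holomorphic branch `L` of `log F`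
on the disc, equal to the principal `log F` on the part of the disc in `Re z > σ₁'`, with
`‖L z‖ ≤ 2M‖z − c‖/(R − ‖z − c‖) + (R + ‖z − c‖)/(R − ‖z − c‖)` (Mathlib's
`Complex.borelCaratheodory`, using `‖log F(c)‖ ≤ 1`). [cite: Titchmarsh1986, §14.2 eq. (14.2.2)] -/
theorem exists_log_borelCaratheodory {F : ℂ → ℂ} {c : ℂ} {R M σ₁' : ℝ} (hR : 0 < R) (hM : 0 < M)
    (hdF : DifferentiableOn ℂ F (ball c R)) (hF0 : ∀ z ∈ ball c R, F z ≠ 0)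
    (hlogF : ∀ z ∈ ball c R, Real.log ‖F z‖ ≤ M)
    (hone : ∀ z : ℂ, σ₁' ≤ z.re → ‖F z - 1‖ ≤ 1 / 2) (hc : σ₁' < c.re) :
    ∃ L : ℂ → ℂ, DifferentiableOn ℂ L (ball c R) ∧ (∀ z ∈ ball c R, exp (L z) = F z) ∧
      (∀ z ∈ ball c R, σ₁' < z.re → L z = log (F z)) ∧
      ∀ z ∈ ball c R, ‖L z‖ ≤ 2 * M * ‖z - c‖ / (R - ‖z - c‖) + (R + ‖z - c‖) / (R - ‖z - c‖) := by
  obtain ⟨L, hLd, hLc, hLder, hexp⟩ := exists_log_of_ball hR hdF hF0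
  -- `L = log F` on `V = disc ∩ {Re z > σ₁'}`
  have hV : ∀ z ∈ ball c R, σ₁' < z.re → L z = log (F z) := by
    set V : Set ℂ := ball c R ∩ {z : ℂ | σ₁' < z.re} with hVdef
    have hVo : IsOpen V := isOpen_ball.inter (isOpen_lt continuous_const continuous_re)
    have hVc : IsPreconnected V :=
      ((convex_ball _ _).inter (convex_halfSpace_re_gt σ₁')).isPreconnected
    have hcV : c ∈ V := ⟨mem_ball_self hR, hc⟩
    have hslit : ∀ z ∈ V, F z ∈ slitPlane := by
      intro z hz
      have h := mem_slitPlane_of_norm_lt_one (z := F z - 1)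
        ((hone z (le_of_lt hz.2)).trans_lt (by norm_num))
      rwa [add_sub_cancel] at h
    have hFat : ∀ z ∈ V, DifferentiableAt ℂ F z := fun z hz ↦
      hdF.differentiableAt (isOpen_ball.mem_nhds hz.1)
    have hLV : DifferentiableOn ℂ L V := hLd.mono inter_subset_left
    have hlogV : DifferentiableOn ℂ (fun z ↦ log (F z)) V := fun z hz ↦
      ((hFat z hz).clog (hslit z hz)).differentiableWithinAt
    have hder : V.EqOn (deriv L) (deriv fun z ↦ log (F z)) := by
      intro z hz
      rw [(hLder z hz.1).deriv, ((hFat z hz).hasDerivAt.clog (hslit z hz)).deriv]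
    have heq := hVo.eqOn_of_deriv_eq hVc hLV hlogV hder hcV hLc
    intro z hz hz2
    exact heq ⟨hz, hz2⟩
  refine ⟨L, hLd, hexp, hV, fun z hz ↦ ?_⟩
  -- Borel–Carathéodory on the disc, translated to the origin
  set f₀ : ℂ → ℂ := fun w ↦ L (c + w) with hf₀
  have hshift : ∀ w ∈ ball (0 : ℂ) R, c + w ∈ ball c R := by
    intro w hw
    rw [mem_ball_zero_iff] at hw
    rwa [mem_ball, dist_eq_norm, add_sub_cancel_left]
  have hf₀d : DifferentiableOn ℂ f₀ (ball 0 R) := by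
    intro w hw
    exact ((hLd.differentiableAt (isOpen_ball.mem_nhds (hshift w hw))).comp w
      ((differentiableAt_const c).add differentiableAt_id)).differentiableWithinAt
  have hmaps : MapsTo f₀ (ball 0 R) {w | w.re ≤ M} := by
    intro w hw
    have hcw := hshift w hw
    show (L (c + w)).re ≤ M
    have hre : (L (c + w)).re = Real.log ‖F (c + w)‖ := by
      rw [← hexp _ hcw, norm_exp, Real.log_exp]
    rw [hre]
    exact hlogF _ hcw
  have hw : z - c ∈ ball (0 : ℂ) R := by
    rw [mem_ball_zero_iff]; rwa [mem_ball, dist_eq_norm] at hz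
  have key := borelCaratheodory hM hf₀d hmaps hR hw
  have hf₀z : f₀ (z - c) = L z := by simp [hf₀]
  have hf₀0 : f₀ 0 = log (F c) := by simp only [hf₀, add_zero]; exact hLc
  rw [hf₀z, hf₀0] at key
  have hBc : ‖log (F c)‖ ≤ 1 := norm_log_le_one_of_norm_sub_one_le (hone c hc.le)
  have hzc : ‖z - c‖ < R := by rwa [mem_ball, dist_eq_norm] at hz
  have hden : 0 < R - ‖z - c‖ := by linarith
  have h2 : ‖log (F c)‖ * (R + ‖z - c‖) / (R - ‖z - c‖) ≤ (R + ‖z - c‖) / (R - ‖z - c‖) := by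
    refine div_le_div_of_nonneg_right ?_ hden.le
    have h0 : 0 ≤ R + ‖z - c‖ := by linarith [norm_nonneg (z - c)]
    calc ‖log (F c)‖ * (R + ‖z - c‖) ≤ 1 * (R + ‖z - c‖) :=
          mul_le_mul_of_nonneg_right hBc h0
      _ = R + ‖z - c‖ := one_mul _
  linarith
set_option maxHeartbeats 400000 in -- buildfix (bf3-g26): 160k/180k FAIL, 200k PASS at accept time; line-neutral budget line
/-- **Zero-freeness upgrades finite order to zero order** (Titchmarsh §14.2; Hilberdink–Lapidus 2006,
Thm. 2.3, Remark (ii)). Let `F` be holomorphic on `{Re s > β} ∖ {1}` with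
`‖F(s)‖ ≤ C_δ |Im s|^A` for `Re s ≥ β + δ`, `|Im s| ≥ 1` (every `δ > 0`), `‖F(s) − 1‖ ≤ 1/2` for
`Re s ≥ σ₁`, and only finitely many zeros in `{Re s > θ} ∖ {1}`, `θ ≥ β`. Then for every `σ₀ > θ`
and `ε > 0` there is `T` with `‖F(s)‖ ≤ |Im s|^ε` whenever `Re s ≥ σ₀`, `|Im s| ≥ T`.
[cite: Titchmarsh1986, §14.2 (proof of Thm 14.2)] -/
theorem norm_le_rpow_of_finite_zeros {F : ℂ → ℂ} {β θ A : ℝ} (hβθ : β ≤ θ)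
    (hd : DifferentiableOn ℂ F {s : ℂ | β < s.re ∧ s ≠ 1})
    (hgrowth : ∀ δ : ℝ, 0 < δ →
      ∃ C : ℝ, ∀ s : ℂ, β + δ ≤ s.re → 1 ≤ |s.im| → ‖F s‖ ≤ C * |s.im| ^ A)
    (hone : ∃ σ₁ : ℝ, ∀ s : ℂ, σ₁ ≤ s.re → ‖F s - 1‖ ≤ 1 / 2)
    (hfin : {s : ℂ | θ < s.re ∧ s ≠ 1 ∧ F s = 0}.Finite)
    {σ₀ ε : ℝ} (hσ₀ : θ < σ₀) (hε : 0 < ε) :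
    ∃ T : ℝ, ∀ s : ℂ, σ₀ ≤ s.re → T ≤ |s.im| → ‖F s‖ ≤ |s.im| ^ ε := by
  obtain ⟨σ₁, hσ₁⟩ := hone
  -- abscissae and radii
  set σ₁' : ℝ := max σ₁ (σ₀ + 1) with hσ₁'
  have hone' : ∀ s : ℂ, σ₁' ≤ s.re → ‖F s - 1‖ ≤ 1 / 2 :=
    fun s hs ↦ hσ₁ s ((le_max_left _ _).trans hs)
  have hσ₀σ₁' : σ₀ + 1 ≤ σ₁' := le_max_right _ _
  set σ₂ : ℝ := σ₁' + 1 with hσ₂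
  set δ : ℝ := (σ₀ - θ) / 2 with hδ
  have hδ0 : 0 < δ := by rw [hδ]; linarith
  set R : ℝ := σ₂ - θ - δ / 2 with hR
  set r₃ : ℝ := σ₂ - θ - δ with hr₃
  have hσ₂σ₀ : σ₂ - σ₀ ≤ r₃ := by rw [hr₃, hδ]; linarith
  have h13 : (1 / 2 : ℝ) < r₃ := by rw [hr₃, hσ₂, hδ]; linarith
  have h3R : r₃ < R := by rw [hr₃, hR]; linarith
  have hR0 : 0 < R := by linarith
  -- growth on `Re s ≥ β + δ/2`
  obtain ⟨C, hC⟩ := hgrowth (δ / 2) (by linarith)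
  set C' : ℝ := max C 1 with hC'
  set A' : ℝ := max A 0 with hA'
  have hC'1 : 1 ≤ C' := le_max_right _ _
  have hA'0 : 0 ≤ A' := le_max_right _ _
  have hgrowth' : ∀ s : ℂ, β + δ / 2 ≤ s.re → 1 ≤ |s.im| → ‖F s‖ ≤ C' * |s.im| ^ A' := by
    intro s hs hsi
    calc ‖F s‖ ≤ C * |s.im| ^ A := hC s hs hsi
      _ ≤ C' * |s.im| ^ A :=
          mul_le_mul_of_nonneg_right (le_max_left _ _) (Real.rpow_nonneg (abs_nonneg _) _)
      _ ≤ C' * |s.im| ^ A' :=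
          mul_le_mul_of_nonneg_left (Real.rpow_le_rpow_of_exponent_le hsi (le_max_left _ _))
            (by linarith)
  -- the ordinates of the zeros are bounded
  obtain ⟨M, hM0, hM⟩ : ∃ M : ℝ, 0 ≤ M ∧ ∀ s : ℂ, θ < s.re → s ≠ 1 → F s = 0 → |s.im| ≤ M := by
    obtain ⟨M₀, hM₀⟩ := (hfin.image fun s : ℂ ↦ |s.im|).bddAbove
    exact ⟨max M₀ 0, le_max_right _ _,
      fun s h1 h2 h3 ↦ (hM₀ ⟨s, ⟨h1, h2, h3⟩, rfl⟩).trans (le_max_left _ _)⟩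
  -- constants
  have hlog2 : 0 ≤ Real.log 2 := Real.log_nonneg (by norm_num)
  have hlogC' : 0 ≤ Real.log C' := Real.log_nonneg hC'1
  have hA'log2 : 0 ≤ A' * Real.log 2 := mul_nonneg hA'0 hlog2
  set K₁ : ℝ := Real.log C' + A' * Real.log 2 + A' + 1 with hK₁
  have hK₁1 : 1 ≤ K₁ := by rw [hK₁]; linarith
  set K₂ : ℝ := max ((4 * K₁ * r₃ + 2 * (R + r₃)) / δ) 1 with hK₂
  have hK₂1 : 1 ≤ K₂ := le_max_right _ _
  have hden : 0 < Real.log (r₃ / (1 / 2)) :=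
    Real.log_pos (by rw [lt_div_iff₀ (by norm_num)]; linarith)
  set a₀ : ℝ := Real.log ((σ₂ - σ₀) / (1 / 2)) / Real.log (r₃ / (1 / 2)) with ha₀
  have hσ₂σ₀' : 1 ≤ σ₂ - σ₀ := by rw [hσ₂]; linarith
  have ha₀1 : a₀ < 1 := by
    rw [ha₀, div_lt_one hden]
    refine Real.log_lt_log (div_pos (by linarith) (by norm_num)) ?_
    rw [div_lt_div_iff_of_pos_right (by norm_num), hr₃, hδ]
    linarith
  have ha₀0 : 0 ≤ a₀ := by
    rw [ha₀]
    exact div_nonneg (Real.log_nonneg (by rw [le_div_iff₀ (by norm_num)]; linarith)) hden.le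
  have h1a₀ : 0 < 1 - a₀ := by linarith
  have hK₂ε : 0 ≤ K₂ / ε := div_nonneg (by linarith) hε.le
  set Y : ℝ := (K₂ / ε) ^ (1 / (1 - a₀)) with hY
  have hY0 : 0 ≤ Y := Real.rpow_nonneg hK₂ε _
  set T₀ : ℝ := M + R + 3 with hT₀
  refine ⟨max T₀ (max (Real.exp Y) ((3 / 2 : ℝ) ^ (1 / ε))), fun s hsσ hst ↦ ?_⟩
  -- unpack `|t| ≥ T`
  set σ : ℝ := s.re with hσdef
  set t : ℝ := s.im with htdef
  have hs_eq : s = (σ : ℂ) + t * I := by rw [hσdef, htdef, re_add_im]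
  have htT₀ : T₀ ≤ |t| := le_trans (le_max_left _ _) hst
  have htY : Real.exp Y ≤ |t| := le_trans (le_max_left _ _) (le_trans (le_max_right _ _) hst)
  have ht32 : (3 / 2 : ℝ) ^ (1 / ε) ≤ |t| :=
    le_trans (le_max_right _ _) (le_trans (le_max_right _ _) hst)
  have ht3 : 3 ≤ |t| := by rw [hT₀] at htT₀; linarith
  have htpos : 0 < |t| := by linarith
  have hlog1 : 1 ≤ Real.log |t| := by
    rw [Real.le_log_iff_exp_le htpos]
    linarith [Real.exp_one_lt_three]
  have hlogt0 : 0 ≤ Real.log |t| := by linarith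
  have hlogY : Y ≤ Real.log |t| := (Real.le_log_iff_exp_le htpos).mpr htY
  -- the far-right case
  by_cases hfar : σ₂ - 1 / 2 < σ
  · have h1 : ‖F s‖ ≤ 3 / 2 := by
      have hs1 := hone' s (by rw [← hσdef]; rw [hσ₂] at hfar; linarith)
      have h' : ‖F s‖ ≤ ‖(1 : ℂ)‖ + ‖F s - 1‖ := by
        have := norm_add_le (1 : ℂ) (F s - 1)
        rwa [add_sub_cancel] at this
      rw [norm_one] at h'
      linarith
    refine h1.trans ?_
    have hbase : (0 : ℝ) ≤ 3 / 2 := by norm_num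
    calc (3 / 2 : ℝ) = (((3 / 2 : ℝ)) ^ (1 / ε)) ^ ε := by
          rw [← Real.rpow_mul hbase, one_div_mul_cancel hε.ne', Real.rpow_one]
      _ ≤ |t| ^ ε := Real.rpow_le_rpow (Real.rpow_nonneg hbase _) ht32 hε.le
  -- the disc case `σ₀ ≤ σ ≤ σ₂ - 1/2`
  have hfar' : σ ≤ σ₂ - 1 / 2 := not_lt.mp hfar
  set c : ℂ := (σ₂ : ℂ) + t * I with hc
  have hc_re : c.re = σ₂ := by simp [hc]
  -- geometry of the Borel–Carathéodory disc
  have hball : ∀ z ∈ ball c R, θ + δ / 2 < z.re ∧ 1 ≤ |z.im| ∧ |z.im| ≤ 2 * |t| ∧ M < |z.im| := by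
    intro z hz
    obtain ⟨hre, him⟩ := re_im_of_mem_ball hz
    have h1 : |t| - R < |z.im| := by
      have := abs_sub_abs_le_abs_sub t z.im
      rw [abs_sub_comm] at this
      linarith
    have h2 : |z.im| < |t| + R := by
      have := abs_sub_abs_le_abs_sub z.im t
      linarith
    rw [hT₀] at htT₀
    refine ⟨by rw [hR] at hre; linarith, by linarith, by linarith, by linarith⟩
  have hmem : ∀ z ∈ ball c R, z ∈ {s : ℂ | β < s.re ∧ s ≠ 1} := by
    intro z hz
    obtain ⟨hre, him, -, -⟩ := hball z hz
    refine ⟨by linarith, fun h1 ↦ ?_⟩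
    rw [h1] at him; simp at him; linarith
  have hopen : IsOpen {s : ℂ | β < s.re ∧ s ≠ 1} :=
    (isOpen_lt continuous_const continuous_re).inter isOpen_ne
  have hdF : DifferentiableOn ℂ F (ball c R) := fun z hz ↦
    (hd.differentiableAt (hopen.mem_nhds (hmem z hz))).differentiableWithinAt
  have hF0 : ∀ z ∈ ball c R, F z ≠ 0 := by
    intro z hz h0
    obtain ⟨hre, him, -, hMz⟩ := hball z hz
    have := hM z (by linarith) (hmem z hz).2 h0
    linarith
  -- the bound `M_t` for `log |F|` on the disc
  set Mt : ℝ := Real.log C' + A' * Real.log (2 * |t|) + 1 with hMt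
  have hlog2t : Real.log (2 * |t|) = Real.log 2 + Real.log |t| :=
    Real.log_mul (by norm_num) htpos.ne'
  have hMt0 : 0 < Mt := by
    have := mul_nonneg hA'0 (add_nonneg hlog2 hlogt0)
    rw [hMt, hlog2t]; linarith
  have hMtK : Mt ≤ K₁ * Real.log |t| := by
    have e1 : Real.log C' * 1 ≤ Real.log C' * Real.log |t| :=
      mul_le_mul_of_nonneg_left hlog1 hlogC'
    have e2 : A' * Real.log 2 * 1 ≤ A' * Real.log 2 * Real.log |t| :=
      mul_le_mul_of_nonneg_left hlog1 hA'log2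
    rw [hMt, hlog2t, hK₁]
    linarith
  have hlogF : ∀ z ∈ ball c R, Real.log ‖F z‖ ≤ Mt := by
    intro z hz
    obtain ⟨hre, him, h2t, -⟩ := hball z hz
    have hpos : 0 < ‖F z‖ := norm_pos_iff.mpr (hF0 z hz)
    have h2t0 : 0 < 2 * |t| := by linarith
    have hFle : ‖F z‖ ≤ C' * (2 * |t|) ^ A' := by
      calc ‖F z‖ ≤ C' * |z.im| ^ A' := hgrowth' z (by linarith) him
        _ ≤ C' * (2 * |t|) ^ A' :=
            mul_le_mul_of_nonneg_left (Real.rpow_le_rpow (abs_nonneg _) h2t hA'0) (by linarith)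
    calc Real.log ‖F z‖ ≤ Real.log (C' * (2 * |t|) ^ A') := Real.log_le_log hpos hFle
      _ = Real.log C' + A' * Real.log (2 * |t|) := by
          rw [Real.log_mul (by linarith) (Real.rpow_pos_of_pos h2t0 _).ne', Real.log_rpow h2t0]
      _ ≤ Mt := by rw [hMt]; linarith
  -- the logarithm on the disc and its Borel–Carathéodory bound
  obtain ⟨L, hLd, hexp, hV, hBC0⟩ := exists_log_borelCaratheodory hR0 hMt0 hdF hF0 hlogF hone'
    (by rw [hc_re, hσ₂]; linarith)
  have hBC : ∀ z : ℂ, ‖z - c‖ ≤ r₃ → ‖L z‖ ≤ K₂ * Real.log |t| := by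
    intro z hzc
    have hz : z ∈ ball c R := by rw [mem_ball, dist_eq_norm]; linarith
    have key := hBC0 z hz
    have hden' : δ / 2 ≤ R - ‖z - c‖ := by rw [hR]; rw [hr₃] at hzc; linarith
    have hδ2pos : 0 < δ / 2 := by linarith
    have hr₃0 : 0 ≤ r₃ := by linarith
    have hn0 : 0 ≤ ‖z - c‖ := norm_nonneg _
    have h1 : 2 * Mt * ‖z - c‖ / (R - ‖z - c‖) ≤ 2 * Mt * r₃ / (δ / 2) :=
      div_le_div₀ (by positivity) (by gcongr) hδ2pos hden'
    have h2 : (R + ‖z - c‖) / (R - ‖z - c‖) ≤ (R + r₃) / (δ / 2) :=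
      div_le_div₀ (by linarith) (by linarith) hδ2pos hden'
    have h3 : 2 * Mt * r₃ / (δ / 2) + (R + r₃) / (δ / 2) = (4 * Mt * r₃ + 2 * (R + r₃)) / δ := by
      field_simp; ring
    have h4 : (4 * Mt * r₃ + 2 * (R + r₃)) / δ ≤
        (4 * K₁ * r₃ + 2 * (R + r₃)) / δ * Real.log |t| := by
      rw [div_mul_eq_mul_div]
      refine div_le_div_of_nonneg_right ?_ hδ0.le
      have e1 : Mt * (4 * r₃) ≤ K₁ * Real.log |t| * (4 * r₃) :=
        mul_le_mul_of_nonneg_right hMtK (by linarith)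
      have e2 : 2 * (R + r₃) * 1 ≤ 2 * (R + r₃) * Real.log |t| :=
        mul_le_mul_of_nonneg_left hlog1 (by linarith)
      linarith
    calc ‖L z‖ ≤ 2 * Mt * ‖z - c‖ / (R - ‖z - c‖) + (R + ‖z - c‖) / (R - ‖z - c‖) := key
      _ ≤ 2 * Mt * r₃ / (δ / 2) + (R + r₃) / (δ / 2) := add_le_add h1 h2
      _ = (4 * Mt * r₃ + 2 * (R + r₃)) / δ := h3
      _ ≤ (4 * K₁ * r₃ + 2 * (R + r₃)) / δ * Real.log |t| := h4
      _ ≤ K₂ * Real.log |t| := mul_le_mul_of_nonneg_right (le_max_left _ _) hlogt0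
  -- three circles at `s = σ + it`: radii `1/2 ≤ σ₂ - σ ≤ r₃`
  have hM₁ : ∀ z : ℂ, ‖z - c‖ = 1 / 2 → ‖L z‖ ≤ 1 := by
    intro z hz
    have hzb : z ∈ ball c R := by rw [mem_ball, dist_eq_norm, hz]; linarith
    have hzre : σ₁' < z.re := by
      have h := abs_re_le_norm (z - c)
      rw [hz] at h
      simp only [sub_re, hc_re] at h
      have := neg_abs_le (z.re - σ₂)
      rw [hσ₂] at this h
      linarith
    rw [hV z hzb hzre]
    exact norm_log_le_one_of_norm_sub_one_le (hone' z hzre.le)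
  have hM₃ : ∀ z : ℂ, ‖z - c‖ = r₃ → ‖L z‖ ≤ K₂ * Real.log |t| := fun z hz ↦ hBC z hz.le
  have hsc : s - c = ((σ - σ₂ : ℝ) : ℂ) := by
    rw [hs_eq, hc]; push_cast; ring
  have hnorm : ‖s - c‖ = σ₂ - σ := by
    rw [hsc, norm_real, Real.norm_eq_abs, abs_of_nonpos (by linarith)]; ring
  have hz₁ : 1 / 2 ≤ ‖s - c‖ := by rw [hnorm]; linarith
  have hz₃ : ‖s - c‖ ≤ r₃ := by rw [hnorm]; linarith
  have key := norm_le_of_three_circles (by norm_num) h13 h3R hLd hM₁ hM₃ hz₁ hz₃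
  have ha0 : 0 ≤ Real.log (‖s - c‖ / (1 / 2)) / Real.log (r₃ / (1 / 2)) :=
    div_nonneg (Real.log_nonneg (by rw [hnorm, le_div_iff₀ (by norm_num)]; linarith)) hden.le
  have ha1 : Real.log (‖s - c‖ / (1 / 2)) / Real.log (r₃ / (1 / 2)) ≤ a₀ := by
    rw [ha₀, hnorm]
    refine div_le_div_of_nonneg_right (Real.log_le_log (div_pos (by linarith) (by norm_num)) ?_)
      hden.le
    rw [div_le_div_iff_of_pos_right (by norm_num)]
    linarith
  have hM₃1 : 1 ≤ K₂ * Real.log |t| := by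
    calc (1 : ℝ) = 1 * 1 := by ring
      _ ≤ K₂ * Real.log |t| := mul_le_mul hK₂1 hlog1 zero_le_one (by linarith)
  have hLs : ‖L s‖ ≤ (K₂ * Real.log |t|) ^ a₀ := by
    refine key.trans ?_
    rw [Real.one_rpow, one_mul]
    exact Real.rpow_le_rpow_of_exponent_le hM₃1 ha1
  -- `(K₂ log|t|)^{a₀} ≤ K₂ (log|t|)^{a₀} ≤ ε log|t|`
  have hKa : (K₂ * Real.log |t|) ^ a₀ ≤ K₂ * Real.log |t| ^ a₀ := by
    rw [Real.mul_rpow (by linarith) hlogt0]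
    refine mul_le_mul_of_nonneg_right ?_ (Real.rpow_nonneg hlogt0 _)
    calc K₂ ^ a₀ ≤ K₂ ^ (1 : ℝ) := Real.rpow_le_rpow_of_exponent_le hK₂1 ha₀1.le
      _ = K₂ := Real.rpow_one K₂
  have hpow : K₂ / ε ≤ Real.log |t| ^ (1 - a₀) := by
    have h1 : Y ^ (1 - a₀) = K₂ / ε := by
      rw [hY, ← Real.rpow_mul hK₂ε, one_div_mul_cancel h1a₀.ne', Real.rpow_one]
    rw [← h1]
    exact Real.rpow_le_rpow hY0 hlogY h1a₀.le
  have hsplit : Real.log |t| = Real.log |t| ^ a₀ * Real.log |t| ^ (1 - a₀) := by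
    rw [← Real.rpow_add (by linarith)]; norm_num
  have hmain : K₂ * Real.log |t| ^ a₀ ≤ ε * Real.log |t| := by
    have hla : 0 ≤ Real.log |t| ^ a₀ := Real.rpow_nonneg hlogt0 _
    calc K₂ * Real.log |t| ^ a₀ = (K₂ / ε) * ε * Real.log |t| ^ a₀ := by field_simp
      _ ≤ Real.log |t| ^ (1 - a₀) * ε * Real.log |t| ^ a₀ := by gcongr
      _ = ε * (Real.log |t| ^ a₀ * Real.log |t| ^ (1 - a₀)) := by ring
      _ = ε * Real.log |t| := by rw [← hsplit]
  have hLs' : ‖L s‖ ≤ ε * Real.log |t| := hLs.trans (hKa.trans hmain)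
  -- `‖F s‖ = exp (Re L s) ≤ exp ‖L s‖ ≤ |t|^ε`
  have hsball : s ∈ ball c R := by
    rw [mem_ball, dist_eq_norm, hnorm]; linarith
  rw [← hexp s hsball, norm_exp, Real.rpow_def_of_pos htpos]
  refine Real.exp_le_exp.mpr ?_
  have : (L s).re ≤ ‖L s‖ := (abs_re_le_norm (L s)).trans' (le_abs_self _)
  linarith

end Literature.Analysis.Complex

end
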